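import Literature.NumberTheory.ConnesMoscovici2022.UVProlateMinDomainBC
import Literature.NumberTheory.ConnesMoscovici2022.UVProlateSymmetryAtInfinity
import Literature.NumberTheory.ConnesMoscovici2022.UVProlateMaxDomainFourier
import HarnessLib

/-!
# Connes–Moscovici 2022, §1: elements of `dom W_min` have no oscillatory tail at `+∞`

LINE 1 — FRAMING. RH-FREE corpus literature (cell rh-crit, C1 Connes–Consani/Moscovici corpus,
row O2 `UVProlateSpectrum`: the self-adjointness theory of the prolate wave operator
`W_λ = −∂ₓ(λ² − x²)∂ₓ + (2πλx)²`; sequel material with no leaf / binder role in any route).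
bears_on: LADDER-RH W-C/W-P.  WHAT THIS IS NOT: any claim about `ζ` or RH; nothing here bears on
the truth of RH.  Theorems only: 0 public `def`s, 0 named facts, no `sorry`.

## Source and purpose

A. Connes, H. Moscovici, *The UV prolate spectrum matches the zeros of zeta*, PNAS 119 (2022)
[ConnesMoscovici2022] = arXiv:2112.05500, §1 (= arXiv §2): the Lagrange/Green identities
(1.4)–(1.8), Lemma 1.2 (iv) ("the restriction of `L` to `Dom W_min` vanishes"), the subspaces
(1.17)–(1.18) and the boundary conditions (1.20)–(1.21) at `±∞` (held text
`paper-arxiv-2112.05500`, chunk p0004:L13–L20, L88–L99; p0005:L24–L55; p0006:L14–L24, L52–L69).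

Companion of `UVProlateMinDomainBC` ((1.19) on `dom W_min`) toward
`hmin : dom W_min ⊆ 𝓛_β`, the input of the von Neumann road to [ConnesMoscovici2022, Thm 1.6 (i)]
(seat cc-t11, `UVProlateThm16Assembly.isSelfAdjoint_prolateSA_of_minDomain_le_of_independent`).
By `UVProlateMaxDomainAsymptotics.exists_asymptotics_atTop_of_ftc` every element of `dom W_max`
behaves like `(A sin 2πλx + B cos 2πλx)/x` at `+∞`; here we prove that BOTH coefficients vanish
for an element that is `W_max`-symmetric against all of `dom W_max` — in particular for
`dom W_min` — so that (1.20)/(1.21) hold there (`tendsto_bcInfEven/Odd_of_asymptotics`).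

* §1 `tendsto_boundaryForm_of_asymptotics` — the sesquilinear boundary term
  `[ξ₁, ξ₂](x) = conj(g₁)·(p g₂′) − conj(p g₁′)·g₂` of (1.4) tends to
  `−2πλ (conj(B₁) A₂ − conj(A₁) B₂)` along the asymptotics of `g₁, g₂` (general value; seat
  cc-t6's `tendsto_form_zero_of_sin/cos_phase` are the vanishing cases).
* §2 `mem_prolateMax_of_contDiff_of_bounded` — `χ ∈ C²(ℝ)` with `χ, χ′` bounded and
  `χ, Wχ ∈ L²` is in `dom W_max` with `W_max χ = −(pχ′)′ + qχ` (Green against Schwartz functions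
  on `[−R, R]`, `p θ, p θ′ → 0`).
* §3 (private) test functions `χ = ψ·(A₂ sin + B₂ cos)(2πλx)/x`, `ψ` a smooth step from `a` to
  `a + 1`: `C²`, zero below `a`, bounded, `χ, Wχ ∈ L²` (`Wχ = λ²ω²T/x + 2λ²T′/x² − 2λ²T/x³` for
  `x > a + 1`), exact asymptotic data `(A₂, B₂)`.
* §4 **`coeffs_eq_zero_of_inner_symm`** — ENGINE: `ξ ∈ dom W_max` with regular representative `g`,
  `W_max`-symmetric against every `ζ ∈ dom W_max`, with `+∞` data `(A, B)` ⟹ `A = B = 0`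
  (`0 = ⟪W_max ξ, ζ_χ⟫ − ⟪ξ, W_max ζ_χ⟫ = ∫_ℝ (conj η·χ − conj g·Wχ) = lim_R [ξ, χ](R)
  = −2πλ (conj(B) A₂ − conj(A) B₂)` by Lagrange on `[λ + ½, R]` and §1; `(A₂, B₂) = (1,0), (0,1)`).

Remaining for `dom W_min ⊆ 𝓛_β` (successor): apply §4 to the even/odd parts `½(ξ ± Rξ)`
(`R` = reflection, `UVProlateMaxDomainFourier.compNeg_mem_prolateMax`; regular representatives
`evenFn g`/`oddFn g` with seat cc-t6's `ftc_evenFn/ftc_oddFn`), conclude (1.20)/(1.21) at `+∞` by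
`tendsto_bcInfEven/Odd_of_asymptotics` with `A = B = 0` and at `−∞` by parity, and combine with
`tendsto_pDeriv_nhdsWithin_zero_of_mem_prolateMin`.  Cell rh-crit seat cc-t14 g3.
-/

noncomputable section

open Complex Set MeasureTheory Filter Topology intervalIntegral Metric
open scoped Real Topology ContDiff InnerProductSpace ComplexConjugate SchwartzMap

namespace Literature.NumberTheory.ConnesMoscovici2022

open Literature.NumberTheory.ConnesConsani2021 Literature.NumberTheory.ConnesConsani2024

variable {lam : ℝ}

/-! ## §0. Private helpers -/

/-- `p′ = −2x`. [folklore] -/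
private theorem hasDerivAt_pCoeff₄ (lam x : ℝ) :
    HasDerivAt (pCoeff lam) (((-(2 * x) : ℝ) : ℂ)) x := by
  have h : HasDerivAt (fun y : ℝ ↦ lam ^ 2 - y ^ 2) (-(2 * x)) x := by
    simpa using (hasDerivAt_pow 2 x).const_sub (lam ^ 2)
  have e : pCoeff lam = fun y : ℝ ↦ (((lam ^ 2 - y ^ 2 : ℝ)) : ℂ) := rfl
  rw [e]
  exact h.ofReal_comp

/-- `p` is continuous. [folklore] -/
private theorem continuous_pCoeff₄ (lam : ℝ) : Continuous (pCoeff lam) := by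
  have e : pCoeff lam = fun y : ℝ ↦ (((lam ^ 2 - y ^ 2 : ℝ)) : ℂ) := rfl
  rw [e]; fun_prop

/-- `q` is continuous. [folklore] -/
private theorem continuous_qCoeff₄ (lam : ℝ) : Continuous (qCoeff lam) := by
  have e : qCoeff lam = fun y : ℝ ↦ ((((2 * π * lam) ^ 2 * y ^ 2 : ℝ)) : ℂ) := rfl
  rw [e]; fun_prop

/-- `‖p(x)‖ = |λ² − x²| ≤ λ² + x²`. [folklore] -/
private theorem norm_pCoeff_le (lam x : ℝ) : ‖pCoeff lam x‖ ≤ lam ^ 2 + x ^ 2 := by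
  rw [pCoeff, Complex.norm_real, Real.norm_eq_abs]
  exact (abs_sub _ _).trans (by rw [abs_of_nonneg (sq_nonneg _), abs_of_nonneg (sq_nonneg _)])

/-- `‖cos θ · z‖ ≤ ‖z‖`. [folklore] -/
private theorem norm_cos_mul_le₄ (t : ℝ) (z : ℂ) : ‖((Real.cos t : ℝ) : ℂ) * z‖ ≤ ‖z‖ := by
  rw [norm_mul]
  refine mul_le_of_le_one_left (norm_nonneg _) ?_
  rw [Complex.norm_real, Real.norm_eq_abs]; exact Real.abs_cos_le_one t

/-- `‖sin θ · z‖ ≤ ‖z‖`. [folklore] -/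
private theorem norm_sin_mul_le₄ (t : ℝ) (z : ℂ) : ‖((Real.sin t : ℝ) : ℂ) * z‖ ≤ ‖z‖ := by
  rw [norm_mul]
  refine mul_le_of_le_one_left (norm_nonneg _) ?_
  rw [Complex.norm_real, Real.norm_eq_abs]; exact Real.abs_sin_le_one t

/-- `‖A sin θ + B cos θ‖ ≤ ‖A‖ + ‖B‖`. [folklore] -/
private theorem norm_trig_comb_le₄ (t : ℝ) (A B : ℂ) :
    ‖A * ((Real.sin t : ℝ) : ℂ) + B * ((Real.cos t : ℝ) : ℂ)‖ ≤ ‖A‖ + ‖B‖ := by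
  refine (norm_add_le _ _).trans (add_le_add ?_ ?_)
  · rw [mul_comm]; exact norm_sin_mul_le₄ t A
  · rw [mul_comm]; exact norm_cos_mul_le₄ t B

/-- `‖A cos θ − B sin θ‖ ≤ ‖A‖ + ‖B‖`. [folklore] -/
private theorem norm_trig_comb_le₄' (t : ℝ) (A B : ℂ) :
    ‖A * ((Real.cos t : ℝ) : ℂ) - B * ((Real.sin t : ℝ) : ℂ)‖ ≤ ‖A‖ + ‖B‖ := by
  refine (norm_sub_le _ _).trans (add_le_add ?_ ?_)
  · rw [mul_comm]; exact norm_cos_mul_le₄ t A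
  · rw [mul_comm]; exact norm_sin_mul_le₄ t B

/-- Bounded × (→ 0) → 0, in norm form. [folklore] -/
private theorem tendsto_zero_of_norm_le_const_mul₄ {l : Filter ℝ} {F G : ℝ → ℂ} {K : ℝ}
    (hle : ∀ x, ‖F x‖ ≤ K * ‖G x‖) (hG : Tendsto G l (𝓝 0)) : Tendsto F l (𝓝 0) := by
  have h : Tendsto (fun x ↦ K * ‖G x‖) l (𝓝 0) := by
    simpa using (tendsto_zero_iff_norm_tendsto_zero.mp hG).const_mul K
  exact squeeze_zero_norm hle h

/-- `d/dt sin(wt) = w cos(wt)`, complexified. [folklore] -/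
private theorem hasDerivAt_sin_ofReal₄ (w t : ℝ) :
    HasDerivAt (fun s : ℝ ↦ ((Real.sin (w * s) : ℝ) : ℂ)) (((w * Real.cos (w * t) : ℝ) : ℂ)) t := by
  have h0 : HasDerivAt (fun s : ℝ ↦ w * s) w t := by simpa using (hasDerivAt_id t).const_mul w
  have h : HasDerivAt (fun s : ℝ ↦ Real.sin (w * s)) (w * Real.cos (w * t)) t :=
    h0.sin.congr_deriv (by ring)
  exact h.ofReal_comp

/-- `d/dt cos(wt) = −w sin(wt)`, complexified. [folklore] -/
private theorem hasDerivAt_cos_ofReal₄ (w t : ℝ) :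
    HasDerivAt (fun s : ℝ ↦ ((Real.cos (w * s) : ℝ) : ℂ)) (((-(w * Real.sin (w * t)) : ℝ) : ℂ)) t := by
  have h0 : HasDerivAt (fun s : ℝ ↦ w * s) w t := by simpa using (hasDerivAt_id t).const_mul w
  have h : HasDerivAt (fun s : ℝ ↦ Real.cos (w * s)) (-(w * Real.sin (w * t))) t :=
    h0.cos.congr_deriv (by ring)
  exact h.ofReal_comp

/-- **Schwartz decay beats `p`**: `p(x) φ(x) → 0` as `|x| → ∞` for a Schwartz function `φ`.
[folklore] -/
private theorem tendsto_pCoeff_mul_schwartz (lam : ℝ) (φ : 𝓢(ℝ, ℂ)) {l : Filter ℝ}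
    (hl : Tendsto (fun x : ℝ ↦ |x|) l atTop) :
    Tendsto (fun x ↦ pCoeff lam x * φ x) l (𝓝 0) := by
  obtain ⟨C, hC0, hC⟩ := φ.decay 3 0
  have hb : ∀ x, |x| ^ 3 * ‖φ x‖ ≤ C := fun x ↦ by
    simpa [norm_iteratedFDeriv_zero, Real.norm_eq_abs] using hC x
  have hlim : Tendsto (fun x : ℝ ↦ (lam ^ 2 + 1) * C * |x|⁻¹) l (𝓝 0) := by
    simpa using hl.inv_tendsto_atTop.const_mul ((lam ^ 2 + 1) * C)
  refine squeeze_zero_norm' ?_ hlim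
  filter_upwards [hl.eventually_ge_atTop 1] with x hx
  have hx0 : 0 < |x| := by linarith
  have hφ : ‖φ x‖ ≤ C / |x| ^ 3 := by
    rw [le_div_iff₀ (by positivity), mul_comm]
    exact hb x
  calc ‖pCoeff lam x * φ x‖ = ‖pCoeff lam x‖ * ‖φ x‖ := norm_mul _ _
    _ ≤ (lam ^ 2 + x ^ 2) * (C / |x| ^ 3) :=
        mul_le_mul (norm_pCoeff_le lam x) hφ (norm_nonneg _) (by positivity)
    _ = (lam ^ 2 * (|x| ^ 2)⁻¹ + 1) * C * |x|⁻¹ := by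
        rw [← sq_abs x]; field_simp
    _ ≤ (lam ^ 2 + 1) * C * |x|⁻¹ := by
        have h1 : (|x| ^ 2)⁻¹ ≤ 1 := inv_le_one_of_one_le₀ (by nlinarith)
        have h2 : lam ^ 2 * (|x| ^ 2)⁻¹ ≤ lam ^ 2 := by nlinarith [sq_nonneg lam]
        gcongr

/-! ## §1. The sesquilinear boundary form along the `+∞` asymptotics -/

section BoundaryFormLimit

/-- **Limit of the sesquilinear boundary form along the `+∞` asymptotics.**  If two functions
`g₁, g₂` satisfy `x gᵢ − (Aᵢ sin + Bᵢ cos)(2πλx) → 0` and `(gᵢ + x gᵢ′) − 2πλ(Aᵢ cos − Bᵢ sin)(2πλx) → 0`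
(the output of `exists_asymptotics_atTop_of_ftc`), then the boundary term of Green's formula
`[ξ₁, ξ₂](x) = conj(g₁)·(p g₂′) − conj(p g₁′)·g₂` (`p = λ² − x²`; the sesquilinear version of the
Wronskian (1.6)) converges at `+∞`:
`[ξ₁, ξ₂](x) → −2πλ (conj(B₁) A₂ − conj(A₁) B₂)` — with `u = x g`, `[ξ₁, ξ₂] = (p/x²)(conj u₁ · u₂′ − conj u₁′ · u₂)`
exactly, `p/x² → −1`, and `sin² + cos² = 1` evaluates the main term.  (Seat cc-t6's
`tendsto_form_zero_of_sin_phase/cos_phase` are the cases where the limit is `0`; the general value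
is what detects the coefficients of a `dom W_min` element below.)
[cite: ConnesMoscovici2022, §1 eqs. (1.5)–(1.8) (= arXiv:2112.05500 (2.5)–(2.8), chunk p0005:L24–L55)] -/
theorem tendsto_boundaryForm_of_asymptotics (lam : ℝ) {g₁ g₂ : ℝ → ℂ} {A₁ B₁ A₂ B₂ : ℂ}
    (h1₁ : Tendsto (fun x : ℝ ↦ (x : ℂ) * g₁ x -
      (A₁ * (Real.sin (2 * π * lam * x) : ℂ) + B₁ * (Real.cos (2 * π * lam * x) : ℂ))) atTop (𝓝 0))
    (h2₁ : Tendsto (fun x : ℝ ↦ (g₁ x + (x : ℂ) * deriv g₁ x) -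
      ((2 * π * lam : ℝ) : ℂ) * (A₁ * (Real.cos (2 * π * lam * x) : ℂ) -
        B₁ * (Real.sin (2 * π * lam * x) : ℂ))) atTop (𝓝 0))
    (h1₂ : Tendsto (fun x : ℝ ↦ (x : ℂ) * g₂ x -
      (A₂ * (Real.sin (2 * π * lam * x) : ℂ) + B₂ * (Real.cos (2 * π * lam * x) : ℂ))) atTop (𝓝 0))
    (h2₂ : Tendsto (fun x : ℝ ↦ (g₂ x + (x : ℂ) * deriv g₂ x) -
      ((2 * π * lam : ℝ) : ℂ) * (A₂ * (Real.cos (2 * π * lam * x) : ℂ) -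
        B₂ * (Real.sin (2 * π * lam * x) : ℂ))) atTop (𝓝 0)) :
    Tendsto (fun x : ℝ ↦ star (g₁ x) * (pCoeff lam x * deriv g₂ x) -
        star (pCoeff lam x * deriv g₁ x) * g₂ x) atTop
      (𝓝 (-((2 * π * lam : ℝ) : ℂ) * (star B₁ * A₂ - star A₁ * B₂))) := by
  -- names: trig factors, main parts, errors
  set sn : ℝ → ℂ := fun x ↦ ((Real.sin (2 * π * lam * x) : ℝ) : ℂ) with hsn
  set cs : ℝ → ℂ := fun x ↦ ((Real.cos (2 * π * lam * x) : ℝ) : ℂ) with hcs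
  set w₀ : ℂ := ((2 * π * lam : ℝ) : ℂ) with hw₀
  set m₁ : ℝ → ℂ := fun x ↦ A₁ * sn x + B₁ * cs x with hm₁
  set m₂ : ℝ → ℂ := fun x ↦ A₂ * sn x + B₂ * cs x with hm₂
  set n₁ : ℝ → ℂ := fun x ↦ w₀ * (A₁ * cs x - B₁ * sn x) with hn₁
  set n₂ : ℝ → ℂ := fun x ↦ w₀ * (A₂ * cs x - B₂ * sn x) with hn₂
  set e₁ : ℝ → ℂ := fun x ↦ (x : ℂ) * g₁ x - m₁ x with he₁
  set e₂ : ℝ → ℂ := fun x ↦ (x : ℂ) * g₂ x - m₂ x with he₂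
  set f₁ : ℝ → ℂ := fun x ↦ (g₁ x + (x : ℂ) * deriv g₁ x) - n₁ x with hf₁
  set f₂ : ℝ → ℂ := fun x ↦ (g₂ x + (x : ℂ) * deriv g₂ x) - n₂ x with hf₂
  have he₁0 : Tendsto e₁ atTop (𝓝 0) := h1₁
  have he₂0 : Tendsto e₂ atTop (𝓝 0) := h1₂
  have hf₁0 : Tendsto f₁ atTop (𝓝 0) := h2₁
  have hf₂0 : Tendsto f₂ atTop (𝓝 0) := h2₂
  have hw₀0 : 0 ≤ ‖w₀‖ := norm_nonneg _
  have hm₁b : ∀ x, ‖m₁ x‖ ≤ ‖A₁‖ + ‖B₁‖ := fun x ↦ norm_trig_comb_le₄ _ _ _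
  have hm₂b : ∀ x, ‖m₂ x‖ ≤ ‖A₂‖ + ‖B₂‖ := fun x ↦ norm_trig_comb_le₄ _ _ _
  have hn₁b : ∀ x, ‖n₁ x‖ ≤ ‖w₀‖ * (‖A₁‖ + ‖B₁‖) := fun x ↦ by
    rw [hn₁]; dsimp only; rw [norm_mul]
    exact mul_le_mul_of_nonneg_left (norm_trig_comb_le₄' _ _ _) hw₀0
  have hn₂b : ∀ x, ‖n₂ x‖ ≤ ‖w₀‖ * (‖A₂‖ + ‖B₂‖) := fun x ↦ by
    rw [hn₂]; dsimp only; rw [norm_mul]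
    exact mul_le_mul_of_nonneg_left (norm_trig_comb_le₄' _ _ _) hw₀0
  have hconj : ∀ {e : ℝ → ℂ}, Tendsto e atTop (𝓝 0) →
      Tendsto (fun x ↦ star (e x)) atTop (𝓝 0) := fun he ↦ by
    have := (continuous_star.tendsto (0 : ℂ)).comp he
    rw [star_zero] at this
    exact this
  have T1 : Tendsto (fun x ↦ star (m₁ x) * f₂ x) atTop (𝓝 0) :=
    tendsto_zero_of_norm_le_const_mul₄ (K := ‖A₁‖ + ‖B₁‖)
      (fun x ↦ by rw [norm_mul, norm_star]; exact mul_le_mul_of_nonneg_right (hm₁b x) (norm_nonneg _))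
      hf₂0
  have T2 : Tendsto (fun x ↦ star (e₁ x) * n₂ x) atTop (𝓝 0) :=
    tendsto_zero_of_norm_le_const_mul₄ (K := ‖w₀‖ * (‖A₂‖ + ‖B₂‖))
      (fun x ↦ by
        rw [norm_mul, norm_star, mul_comm]
        exact mul_le_mul_of_nonneg_right (hn₂b x) (norm_nonneg _))
      he₁0
  have T3 : Tendsto (fun x ↦ star (e₁ x) * f₂ x) atTop (𝓝 0) := by
    simpa using (hconj he₁0).mul hf₂0
  have T4 : Tendsto (fun x ↦ star (n₁ x) * e₂ x) atTop (𝓝 0) :=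
    tendsto_zero_of_norm_le_const_mul₄ (K := ‖w₀‖ * (‖A₁‖ + ‖B₁‖))
      (fun x ↦ by rw [norm_mul, norm_star]; exact mul_le_mul_of_nonneg_right (hn₁b x) (norm_nonneg _))
      he₂0
  have T5 : Tendsto (fun x ↦ star (f₁ x) * m₂ x) atTop (𝓝 0) :=
    tendsto_zero_of_norm_le_const_mul₄ (K := ‖A₂‖ + ‖B₂‖)
      (fun x ↦ by
        rw [norm_mul, norm_star, mul_comm]
        exact mul_le_mul_of_nonneg_right (hm₂b x) (norm_nonneg _))
      hf₁0
  have T6 : Tendsto (fun x ↦ star (f₁ x) * e₂ x) atTop (𝓝 0) := by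
    simpa using (hconj hf₁0).mul he₂0
  set L : ℂ := w₀ * (star B₁ * A₂ - star A₁ * B₂) with hL
  have hE : Tendsto (fun x : ℝ ↦ star ((x : ℂ) * g₁ x) * (g₂ x + (x : ℂ) * deriv g₂ x) -
      star (g₁ x + (x : ℂ) * deriv g₁ x) * ((x : ℂ) * g₂ x)) atTop (𝓝 L) := by
    have hsum := ((((tendsto_const_nhds (x := L)).add T1).add T2).add T3).sub ((T4.add T5).add T6)
    simp only [add_zero, sub_zero] at hsum
    refine hsum.congr' (Eventually.of_forall fun x ↦ ?_)
    have h := Complex.cos_sq_add_sin_sq (2 * (π : ℂ) * (lam : ℂ) * (x : ℂ))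
    have ev₁ : (x : ℂ) * g₁ x = m₁ x + e₁ x := by simp only [he₁]; ring
    have ev₂ : (x : ℂ) * g₂ x = m₂ x + e₂ x := by simp only [he₂]; ring
    have ev₁' : g₁ x + (x : ℂ) * deriv g₁ x = n₁ x + f₁ x := by simp only [hf₁]; ring
    have ev₂' : g₂ x + (x : ℂ) * deriv g₂ x = n₂ x + f₂ x := by simp only [hf₂]; ring
    beta_reduce
    rw [ev₁, ev₂, ev₁', ev₂']
    simp only [hL, hm₁, hm₂, hn₁, hn₂, hsn, hcs, hw₀, star_add, star_mul', star_sub,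
      Complex.star_def, Complex.conj_ofReal]
    push_cast
    linear_combination (-(2 * (π : ℂ) * (lam : ℂ)) *
      ((starRingEnd ℂ) B₁ * A₂ - (starRingEnd ℂ) A₁ * B₂)) * h
  have hpx : Tendsto (fun x : ℝ ↦ pCoeff lam x / (x : ℂ) ^ 2) atTop (𝓝 (-1)) := by
    have h1 : Tendsto (fun x : ℝ ↦ lam ^ 2 * (x ^ 2)⁻¹ - 1) atTop (𝓝 (lam ^ 2 * 0 - 1)) :=
      ((tendsto_inv_atTop_zero.comp (tendsto_pow_atTop two_ne_zero)).const_mul _).sub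
        tendsto_const_nhds
    rw [mul_zero, zero_sub] at h1
    have h2 := (Complex.continuous_ofReal.tendsto (-1)).comp h1
    refine (h2.congr' ?_).trans (by simp)
    filter_upwards [eventually_gt_atTop 0] with x hx
    have hx0 : (x : ℂ) ≠ 0 := Complex.ofReal_ne_zero.2 hx.ne'
    simp only [Function.comp, pCoeff]
    push_cast
    field_simp
  have hprod := hpx.mul hE
  have : (-1 : ℂ) * L = -w₀ * (star B₁ * A₂ - star A₁ * B₂) := by rw [hL]; ring
  rw [this] at hprod
  refine hprod.congr' ?_
  filter_upwards [eventually_gt_atTop 0] with x hx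
  have hx0 : (x : ℂ) ≠ 0 := Complex.ofReal_ne_zero.2 hx.ne'
  have hpreal : star (pCoeff lam x) = pCoeff lam x := by rw [pCoeff]; exact Complex.conj_ofReal _
  simp only [star_mul', star_add, hpreal, Complex.star_def, Complex.conj_ofReal]
  field_simp
  ring

end BoundaryFormLimit

/-! ## §2. Bounded `C²` functions with `χ, Wχ ∈ L²` are in `dom W_max` -/

section Membership

/-- **Green against Schwartz functions on all of `ℝ`.**  Let `χ ∈ C²(ℝ)` with `χ, χ′` bounded and
`χ, Wχ := −(pχ′)′ + qχ ∈ L²(ℝ)`.  Then `[χ] ∈ dom W_max` and `W_max [χ] = [Wχ]`: for a Schwartz `θ`,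
`∫_{−R}^{R} ((Wθ)χ − θ(Wχ)) = [θ·(pχ′) − pθ′·χ]_{−R}^{R} → 0` since `p θ, p θ′ → 0` at `±∞`.
("`W_max` is the operator defined on the distribution space … restricted to those `L²`-functions
`ξ` such that the distribution `Wξ ∈ L²(ℝ)`" — for such `χ` the distribution `Wχ` is the classical
one.) [cite: ConnesMoscovici2022, §1 ¶1, definition of `W_max` (= arXiv:2112.05500 §2 ¶1, chunk p0004:L13–L20)] -/
theorem mem_prolateMax_of_contDiff_of_bounded (lam : ℝ) {χ : ℝ → ℂ} (hχ : ContDiff ℝ 2 χ) {C : ℝ}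
    (hb : ∀ x, ‖χ x‖ ≤ C) (hb' : ∀ x, ‖deriv χ x‖ ≤ C) (h2 : MemLp χ 2 volume)
    (hW2 : MemLp (fun t ↦ -deriv (fun s ↦ pCoeff lam s * deriv χ s) t + qCoeff lam t * χ t)
      2 volume) :
    ∃ hdom : h2.toLp χ ∈ (prolateMax lam).domain,
      prolateMax lam ⟨h2.toLp χ, hdom⟩ = hW2.toLp _ := by
  -- `χ ∈ C²`: derivative bookkeeping
  have h2' : ContDiff ℝ (1 + 1) χ := by simpa [one_add_one_eq_two] using hχ
  have hχ'1 : ContDiff ℝ 1 (deriv χ) := (contDiff_succ_iff_deriv.mp h2').2.2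
  have hχ'd : Differentiable ℝ (deriv χ) := hχ'1.differentiable one_ne_zero
  have hχ''c : Continuous (deriv (deriv χ)) := hχ'1.continuous_deriv le_rfl
  have hχ1 : ContDiff ℝ 1 χ := hχ.of_le (by norm_num)
  set u : ℝ → ℂ := fun s ↦ pCoeff lam s * deriv χ s with hu
  have hud : ∀ s, HasDerivAt u
      (((-(2 * s) : ℝ) : ℂ) * deriv χ s + pCoeff lam s * deriv (deriv χ) s) s := fun s ↦
    (hasDerivAt_pCoeff₄ lam s).mul (hχ'd s).hasDerivAt
  have hu' : deriv u = fun s ↦ ((-(2 * s) : ℝ) : ℂ) * deriv χ s + pCoeff lam s * deriv (deriv χ) s :=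
    funext fun s ↦ (hud s).deriv
  have hu'c : Continuous (deriv u) := by
    rw [hu']
    exact ((Complex.continuous_ofReal.comp (by fun_prop)).mul hχ'1.continuous).add
      ((continuous_pCoeff₄ lam).mul hχ''c)
  set Wχ : ℝ → ℂ := fun t ↦ -deriv (fun s ↦ pCoeff lam s * deriv χ s) t + qCoeff lam t * χ t
    with hWχ
  have hC0 : 0 ≤ C := (norm_nonneg _).trans (hb 0)
  have hweak : ∀ θ : 𝓢(ℝ, ℂ),
      ∫ x, prolateSchwartz lam θ x * (h2.toLp χ : L2R) x = ∫ x, θ x * (hW2.toLp _ : L2R) x := by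
    intro θ
    have hθ2 : ContDiff ℝ 2 θ := θ.smooth 2
    have e1 : ∫ x, prolateSchwartz lam θ x * (h2.toLp χ : L2R) x =
        ∫ x, prolateSchwartz lam θ x * χ x :=
      integral_congr_ae (by filter_upwards [h2.coeFn_toLp] with x hx; rw [hx])
    have e2 : ∫ x, θ x * (hW2.toLp _ : L2R) x = ∫ x, θ x * Wχ x :=
      integral_congr_ae (by filter_upwards [hW2.coeFn_toLp] with x hx; rw [hx])
    rw [e1, e2, ← sub_eq_zero]
    -- the integrand `D = (Wθ)χ − θ(Wχ)` is integrable on `ℝ`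
    have hi1 : Integrable (fun x ↦ prolateSchwartz lam θ x * χ x) :=
      ((prolateSchwartz lam θ).memLp 2 volume).integrable_mul h2
    have hi2 : Integrable (fun x ↦ θ x * Wχ x) := (θ.memLp 2 volume).integrable_mul hW2
    rw [← integral_sub hi1 hi2]
    set D : ℝ → ℂ := fun x ↦ prolateSchwartz lam θ x * χ x - θ x * Wχ x with hD
    set B : ℝ → ℂ := fun s ↦ θ s * (pCoeff lam s * deriv χ s) - pCoeff lam s * deriv θ s * χ s
      with hB
    -- Green on `[−R, R]`
    have hGreen : ∀ R : ℝ, 0 ≤ R → ∫ t in (-R)..R, D t = B R - B (-R) := by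
      intro R hR
      have hF : ∀ s ∈ Icc (-R) R, pCoeff lam s * deriv χ s - pCoeff lam (-R) * deriv χ (-R) =
          ∫ t in (-R)..s, deriv u t := by
        intro s _
        rw [intervalIntegral.integral_deriv_eq_sub (fun t _ ↦ (hud t).differentiableAt)
          (hu'c.intervalIntegrable _ _)]
      have hG := intervalIntegral_green_of_contDiffOn lam (by linarith : -R ≤ R) isOpen_univ
        (subset_univ _) hθ2 hχ1.contDiffOn hF (hu'c.intervalIntegrable _ _)
      have e : ∀ t ∈ uIcc (-R) R, D t =
          (-deriv (fun s ↦ pCoeff lam s * deriv θ s) t + qCoeff lam t * θ t) * χ t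
            - θ t * (qCoeff lam t * χ t - deriv u t) := by
        intro t _
        simp only [hD, hWχ, hu, prolateSchwartz_apply']
        ring
      rw [intervalIntegral.integral_congr e, hG]
    -- the boundary term dies at `±∞`
    have hBlim : ∀ {l : Filter ℝ}, Tendsto (fun x : ℝ ↦ |x|) l atTop → Tendsto B l (𝓝 0) := by
      intro l hl
      have t1 : Tendsto (fun s ↦ θ s * (pCoeff lam s * deriv χ s)) l (𝓝 0) := by
        refine tendsto_zero_of_norm_le_const_mul₄ (K := C) (G := fun s ↦ pCoeff lam s * θ s)
          (fun s ↦ ?_) (tendsto_pCoeff_mul_schwartz lam θ hl)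
        simp only [norm_mul]
        calc ‖θ s‖ * (‖pCoeff lam s‖ * ‖deriv χ s‖)
            = (‖pCoeff lam s‖ * ‖θ s‖) * ‖deriv χ s‖ := by ring
          _ ≤ (‖pCoeff lam s‖ * ‖θ s‖) * C := mul_le_mul_of_nonneg_left (hb' s) (by positivity)
          _ = C * (‖pCoeff lam s‖ * ‖θ s‖) := by ring
      have t2 : Tendsto (fun s ↦ pCoeff lam s * deriv θ s * χ s) l (𝓝 0) := by
        refine tendsto_zero_of_norm_le_const_mul₄ (K := C)
          (G := fun s ↦ pCoeff lam s * SchwartzMap.derivCLM ℝ ℂ θ s) (fun s ↦ ?_)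
          (tendsto_pCoeff_mul_schwartz lam _ hl)
        rw [SchwartzMap.derivCLM_apply]
        simp only [norm_mul]
        calc ‖pCoeff lam s‖ * ‖deriv θ s‖ * ‖χ s‖
            ≤ ‖pCoeff lam s‖ * ‖deriv θ s‖ * C := mul_le_mul_of_nonneg_left (hb s) (by positivity)
          _ = C * (‖pCoeff lam s‖ * ‖deriv θ s‖) := by ring
      simpa [hB] using t1.sub t2
    have hTop : Tendsto B atTop (𝓝 0) := hBlim tendsto_abs_atTop_atTop
    have hBot : Tendsto (fun R : ℝ ↦ B (-R)) atTop (𝓝 0) :=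
      (hBlim tendsto_abs_atBot_atTop).comp tendsto_neg_atTop_atBot
    -- pass to the limit
    have hlim1 : Tendsto (fun R : ℝ ↦ ∫ t in (-R)..R, D t) atTop (𝓝 (∫ t, D t)) :=
      intervalIntegral_tendsto_integral (hi1.sub hi2) tendsto_neg_atTop_atBot tendsto_id
    have hlim2 : Tendsto (fun R : ℝ ↦ ∫ t in (-R)..R, D t) atTop (𝓝 0) := by
      have h := hTop.sub hBot
      rw [sub_zero] at h
      refine h.congr' ?_
      filter_upwards [eventually_ge_atTop 0] with R hR
      exact (hGreen R hR).symm
    exact tendsto_nhds_unique hlim1 hlim2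
  exact exists_prolateMax_eq_of_forall_integral lam hweak

end Membership

/-! ## §3. Test functions with prescribed `+∞` asymptotics -/

section TestFunction

/-- `‖star f‖₂ = ‖f‖₂`: conjugation preserves `L²`. [folklore] -/
private theorem memLp_two_star₄ {f : ℝ → ℂ} (hf : MemLp f 2 volume) :
    MemLp (fun t ↦ star (f t)) 2 volume :=
  MemLp.of_le hf (continuous_star.comp_aestronglyMeasurable hf.1)
    (Eventually.of_forall fun t ↦ by rw [norm_star])

/-- `x ↦ K/x` is in `L²([a, ∞))` for `a > 0` (as the function `1_{[a,∞)} · K x⁻¹` on `ℝ`). [folklore] -/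
private theorem memLp_indicator_inv {a : ℝ} (ha : 0 < a) (K : ℝ) :
    MemLp ((Ici a).indicator fun x : ℝ ↦ ((K * x⁻¹ : ℝ) : ℂ)) 2 volume := by
  rw [memLp_indicator_iff_restrict measurableSet_Ici]
  have hmeas : AEStronglyMeasurable (fun x : ℝ ↦ ((K * x⁻¹ : ℝ) : ℂ)) (volume.restrict (Ici a)) :=
    (Complex.continuous_ofReal.measurable.comp (measurable_const.mul measurable_inv)).aestronglyMeasurable
  refine (memLp_two_iff_integrable_sq_norm hmeas).2 ?_
  have hrpow : IntegrableOn (fun x : ℝ ↦ x ^ (-2 : ℝ)) (Ici a) :=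
    (integrableOn_Ici_iff_integrableOn_Ioi).2 (integrableOn_Ioi_rpow_of_lt (by norm_num) ha)
  have h1 : IntegrableOn (fun x : ℝ ↦ K ^ 2 * x ^ (-2 : ℝ)) (Ici a) := hrpow.const_mul _
  refine h1.congr_fun (fun x hx ↦ ?_) measurableSet_Ici
  have hx : 0 < x := ha.trans_le hx
  beta_reduce
  rw [Complex.norm_real, Real.norm_eq_abs, sq_abs, mul_pow, inv_pow, Real.rpow_neg hx.le,
    Real.rpow_two]

/-- **Test functions.**  For `a ≥ 1` and `A₂, B₂ ∈ ℂ` there is `χ ∈ C²(ℝ)`, vanishing on `(−∞, a)`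
together with `Wχ = −(pχ′)′ + qχ`, with `χ, χ′` bounded, `χ, Wχ ∈ L²(ℝ)`, and EXACT asymptotics
`x χ(x) = A₂ sin(2πλx) + B₂ cos(2πλx)`, `(χ + xχ′)(x) = 2πλ(A₂ cos − B₂ sin)(2πλx)` for `x > a + 1`
(namely `χ = ψ · (A₂ sin + B₂ cos)(2πλx)/x` with `ψ` a smooth step from `a` to `a + 1`; for
`x > a + 1`, `Wχ = λ²ω² T/x + 2λ² T′/x² − 2λ² T/x³ = O(1/x)`).  [folklore] -/
private theorem exists_testFunction (lam : ℝ) {a : ℝ} (ha : 1 ≤ a) (A₂ B₂ : ℂ) :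
    ∃ χ : ℝ → ℂ, ContDiff ℝ 2 χ ∧ (∀ x, x < a → χ x = 0) ∧ (∀ x, x < a → deriv χ x = 0) ∧
      (∀ x, x < a → -deriv (fun s ↦ pCoeff lam s * deriv χ s) x + qCoeff lam x * χ x = 0) ∧
      (∃ C, (∀ x, ‖χ x‖ ≤ C) ∧ (∀ x, ‖deriv χ x‖ ≤ C)) ∧
      MemLp χ 2 volume ∧
      MemLp (fun t ↦ -deriv (fun s ↦ pCoeff lam s * deriv χ s) t + qCoeff lam t * χ t) 2 volume ∧
      (∀ x, a + 1 < x → (x : ℂ) * χ x =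
        A₂ * (Real.sin (2 * π * lam * x) : ℂ) + B₂ * (Real.cos (2 * π * lam * x) : ℂ)) ∧
      (∀ x, a + 1 < x → χ x + (x : ℂ) * deriv χ x =
        ((2 * π * lam : ℝ) : ℂ) * (A₂ * (Real.cos (2 * π * lam * x) : ℂ) -
          B₂ * (Real.sin (2 * π * lam * x) : ℂ))) := by
  have ha0 : 0 < a := by linarith
  -- the trigonometric profile `T` and its derivatives
  set w : ℝ := 2 * π * lam with hw
  set sn : ℝ → ℂ := fun x ↦ ((Real.sin (w * x) : ℝ) : ℂ) with hsn
  set cs : ℝ → ℂ := fun x ↦ ((Real.cos (w * x) : ℝ) : ℂ) with hcs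
  set T : ℝ → ℂ := fun x ↦ A₂ * sn x + B₂ * cs x with hT
  set T₁ : ℝ → ℂ := fun x ↦ (w : ℂ) * (A₂ * cs x - B₂ * sn x) with hT₁
  have hsnd : ∀ t, HasDerivAt sn ((w : ℂ) * cs t) t := fun t ↦
    (hasDerivAt_sin_ofReal₄ w t).congr_deriv (by simp [hcs])
  have hcsd : ∀ t, HasDerivAt cs (-((w : ℂ) * sn t)) t := fun t ↦
    (hasDerivAt_cos_ofReal₄ w t).congr_deriv (by simp [hsn])
  have hTd : ∀ t, HasDerivAt T (T₁ t) t := fun t ↦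
    (((hsnd t).const_mul A₂).add ((hcsd t).const_mul B₂)).congr_deriv (by simp only [hT₁]; ring)
  have hT₁d : ∀ t, HasDerivAt T₁ (-(w : ℂ) ^ 2 * T t) t := fun t ↦
    ((((hcsd t).const_mul A₂).sub ((hsnd t).const_mul B₂)).const_mul (w : ℂ)).congr_deriv
      (by simp only [hT]; ring)
  have hTc : ContDiff ℝ 2 T := by
    have h1 : ContDiff ℝ 2 sn := Complex.ofRealCLM.contDiff.comp
      (Real.contDiff_sin.comp (contDiff_const.mul contDiff_id))
    have h2 : ContDiff ℝ 2 cs := Complex.ofRealCLM.contDiff.comp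
      (Real.contDiff_cos.comp (contDiff_const.mul contDiff_id))
    exact (contDiff_const.mul h1).add (contDiff_const.mul h2)
  set M : ℝ := ‖A₂‖ + ‖B₂‖ with hM
  have hM0 : 0 ≤ M := by positivity
  have hTb : ∀ x, ‖T x‖ ≤ M := fun x ↦ norm_trig_comb_le₄ _ _ _
  have hT₁b : ∀ x, ‖T₁ x‖ ≤ |w| * M := fun x ↦ by
    simp only [hT₁]; rw [norm_mul, Complex.norm_real, Real.norm_eq_abs]
    exact mul_le_mul_of_nonneg_left (norm_trig_comb_le₄' _ _ _) (abs_nonneg _)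
  -- the smooth step `ψ` from `a` to `a + 1`
  set ψ : ℝ → ℝ := fun x ↦ Real.smoothTransition (x - a) with hψ
  have hψc : ContDiff ℝ 2 (fun x ↦ ((ψ x : ℝ) : ℂ)) := Complex.ofRealCLM.contDiff.comp
    (Real.smoothTransition.contDiff.comp (contDiff_id.sub contDiff_const))
  have hψ0 : ∀ x, x ≤ a → ψ x = 0 := fun x hx ↦ Real.smoothTransition.zero_of_nonpos (by linarith)
  have hψ1 : ∀ x, a + 1 ≤ x → ψ x = 1 := fun x hx ↦ Real.smoothTransition.one_of_one_le (by linarith)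
  have hψ01 : ∀ x, 0 ≤ ψ x ∧ ψ x ≤ 1 := fun x ↦
    ⟨Real.smoothTransition.nonneg _, Real.smoothTransition.le_one _⟩
  -- the explicit profile `f = T/x` and its derivative `f₁` (valid for `x ≠ 0`)
  set f : ℝ → ℂ := fun x ↦ T x / (x : ℂ) with hf
  set f₁ : ℝ → ℂ := fun x ↦ (T₁ x * x - T x) / (x : ℂ) ^ 2 with hf₁
  have hfd : ∀ x : ℝ, x ≠ 0 → HasDerivAt f (f₁ x) x := by
    intro x hx
    have hx' : (x : ℂ) ≠ 0 := Complex.ofReal_ne_zero.2 hx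
    have h := (hTd x).div (Complex.ofRealCLM.hasDerivAt (x := x)) hx'
    refine h.congr_deriv ?_
    simp only [hf₁, Complex.ofRealCLM_apply, Complex.ofReal_one, mul_one]
  have hf₁d : ∀ x : ℝ, x ≠ 0 → HasDerivAt f₁
      (((-(w : ℂ) ^ 2 * T x * x + T₁ x * 1 - T₁ x) * (x : ℂ) ^ 2 -
        (T₁ x * x - T x) * (2 * (x : ℂ))) / ((x : ℂ) ^ 2) ^ 2) x := by
    intro x hx
    have hx' : (x : ℂ) ^ 2 ≠ 0 := pow_ne_zero 2 (Complex.ofReal_ne_zero.2 hx)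
    have hN : HasDerivAt (fun y : ℝ ↦ T₁ y * y - T y) (-(w : ℂ) ^ 2 * T x * x + T₁ x * 1 - T₁ x) x :=
      ((hT₁d x).mul (Complex.ofRealCLM.hasDerivAt (x := x))).sub (hTd x)
    have hD : HasDerivAt (fun y : ℝ ↦ (y : ℂ) ^ 2) (2 * (x : ℂ)) x := by
      have h := (hasDerivAt_pow 2 x).ofReal_comp
      have e : (fun y : ℝ ↦ (((y ^ 2 : ℝ)) : ℂ)) = fun y : ℝ ↦ (y : ℂ) ^ 2 := by
        funext y; push_cast; rfl
      rw [e] at h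
      exact h.congr_deriv (by push_cast; norm_num)
    exact (hN.div hD hx').congr_deriv (by simp)
  -- the test function
  set χ : ℝ → ℂ := fun x ↦ ((ψ x : ℝ) : ℂ) * f x with hχ
  have hχ0 : ∀ x, x < a → χ x = 0 := fun x hx ↦ by
    simp only [hχ, hψ0 x hx.le, Complex.ofReal_zero, zero_mul]
  have hχev0 : ∀ x, x < a → χ =ᶠ[𝓝 x] fun _ ↦ (0 : ℂ) := fun x hx ↦ by
    filter_upwards [Iio_mem_nhds hx] with y hy using hχ0 y hy
  have hχevf : ∀ x, a + 1 < x → χ =ᶠ[𝓝 x] f := fun x hx ↦ by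
    filter_upwards [Ioi_mem_nhds hx] with y hy
    simp only [hχ, hψ1 y (le_of_lt hy), Complex.ofReal_one, one_mul]
  -- smoothness
  have hχC : ContDiff ℝ 2 χ := by
    rw [contDiff_iff_contDiffAt]
    intro x
    by_cases hx : x < a
    · exact contDiffAt_const.congr_of_eventuallyEq (hχev0 x hx)
    · have hx0 : (x : ℂ) ≠ 0 := Complex.ofReal_ne_zero.2 (by linarith)
      have hfx : ContDiffAt ℝ 2 f x :=
        hTc.contDiffAt.mul (Complex.ofRealCLM.contDiff.contDiffAt.inv hx0)
      exact hψc.contDiffAt.mul hfx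
  have h2' : ContDiff ℝ (1 + 1) χ := by simpa [one_add_one_eq_two] using hχC
  have hχd : Differentiable ℝ χ := (contDiff_succ_iff_deriv.mp h2').1
  have hχ'1 : ContDiff ℝ 1 (deriv χ) := (contDiff_succ_iff_deriv.mp h2').2.2
  have hχ'd : Differentiable ℝ (deriv χ) := hχ'1.differentiable one_ne_zero
  have hχ''c : Continuous (deriv (deriv χ)) := hχ'1.continuous_deriv le_rfl
  set u : ℝ → ℂ := fun s ↦ pCoeff lam s * deriv χ s with hu
  have hud : ∀ s, HasDerivAt u
      (((-(2 * s) : ℝ) : ℂ) * deriv χ s + pCoeff lam s * deriv (deriv χ) s) s := fun s ↦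
    (hasDerivAt_pCoeff₄ lam s).mul (hχ'd s).hasDerivAt
  have hu'c : Continuous (deriv u) := by
    rw [show deriv u = _ from funext fun s ↦ (hud s).deriv]
    exact ((Complex.continuous_ofReal.comp (by fun_prop)).mul hχ'1.continuous).add
      ((continuous_pCoeff₄ lam).mul hχ''c)
  set Wχ : ℝ → ℂ := fun t ↦ -deriv (fun s ↦ pCoeff lam s * deriv χ s) t + qCoeff lam t * χ t
    with hWχ
  have hWχc : Continuous Wχ := hu'c.neg.add ((continuous_qCoeff₄ lam).mul hχC.continuous)
  -- zero region
  have hχ'0 : ∀ x, x < a → deriv χ x = 0 := fun x hx ↦ by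
    rw [(hχev0 x hx).deriv_eq, deriv_const]
  have hW0 : ∀ x, x < a → Wχ x = 0 := by
    intro x hx
    have hev : (fun s ↦ pCoeff lam s * deriv χ s) =ᶠ[𝓝 x] fun _ ↦ (0 : ℂ) := by
      filter_upwards [Iio_mem_nhds hx] with y hy
      rw [hχ'0 y hy, mul_zero]
    simp only [hWχ, hev.deriv_eq, deriv_const, hχ0 x hx, neg_zero, mul_zero, add_zero]
  -- explicit region `x > a + 1`
  have hχ'f : ∀ x, a + 1 < x → deriv χ x = f₁ x := fun x hx ↦ by
    rw [(hχevf x hx).deriv_eq]; exact (hfd x (by linarith)).deriv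
  have hWf : ∀ x, a + 1 < x → Wχ x =
      ((lam ^ 2 * w ^ 2 : ℝ) : ℂ) * T x / x + ((2 * lam ^ 2 : ℝ) : ℂ) * T₁ x / (x : ℂ) ^ 2 -
        ((2 * lam ^ 2 : ℝ) : ℂ) * T x / (x : ℂ) ^ 3 := by
    intro x hx
    have hx0 : x ≠ 0 := by linarith
    have hx' : (x : ℂ) ≠ 0 := Complex.ofReal_ne_zero.2 hx0
    have hev : (fun s ↦ pCoeff lam s * deriv χ s) =ᶠ[𝓝 x] fun s ↦ pCoeff lam s * f₁ s := by
      filter_upwards [Ioi_mem_nhds hx] with y hy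
      rw [hχ'f y hy]
    have huf : HasDerivAt (fun s ↦ pCoeff lam s * f₁ s)
        (((-(2 * x) : ℝ) : ℂ) * f₁ x + pCoeff lam x *
          (((-(w : ℂ) ^ 2 * T x * x + T₁ x * 1 - T₁ x) * (x : ℂ) ^ 2 -
            (T₁ x * x - T x) * (2 * (x : ℂ))) / ((x : ℂ) ^ 2) ^ 2)) x :=
      (hasDerivAt_pCoeff₄ lam x).mul (hf₁d x hx0)
    have eχ : χ x = f x := (hχevf x hx).eq_of_nhds
    rw [show Wχ x = -deriv (fun s ↦ pCoeff lam s * deriv χ s) x + qCoeff lam x * χ x from rfl,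
      hev.deriv_eq, huf.deriv, eχ]
    simp only [hf, hf₁, pCoeff, qCoeff]
    rw [← hw]
    push_cast
    field_simp
    ring
  -- bounds
  have hχb : ∀ x, ‖χ x‖ ≤ M := by
    intro x
    by_cases hx : x < a
    · rw [hχ0 x hx, norm_zero]; exact hM0
    · have hx1 : 1 ≤ x := by linarith
      have hxpos : 0 < x := by linarith
      simp only [hχ, hf]
      rw [norm_mul, norm_div, Complex.norm_real, Complex.norm_real, Real.norm_eq_abs,
        Real.norm_eq_abs, abs_of_nonneg (hψ01 x).1, abs_of_pos hxpos]
      calc ψ x * (‖T x‖ / x) ≤ 1 * M :=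
            mul_le_mul (hψ01 x).2 ((div_le_self (norm_nonneg _) hx1).trans (hTb x))
              (by positivity) zero_le_one
        _ = M := one_mul M
  have hf₁b : ∀ x, 1 ≤ x → ‖f₁ x‖ ≤ |w| * M + M := by
    intro x hx1
    have hxpos : 0 < x := by linarith
    simp only [hf₁]
    rw [norm_div, norm_pow, Complex.norm_real, Real.norm_eq_abs, abs_of_pos hxpos]
    rw [div_le_iff₀ (by positivity)]
    calc ‖T₁ x * x - T x‖ ≤ ‖T₁ x * x‖ + ‖T x‖ := norm_sub_le _ _
      _ = ‖T₁ x‖ * x + ‖T x‖ := by rw [norm_mul, Complex.norm_real, Real.norm_eq_abs, abs_of_pos hxpos]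
      _ ≤ |w| * M * x + M := add_le_add (mul_le_mul_of_nonneg_right (hT₁b x) hxpos.le) (hTb x)
      _ ≤ (|w| * M + M) * x ^ 2 := by
          nlinarith [mul_nonneg (mul_nonneg (abs_nonneg w) hM0) (show 0 ≤ x ^ 2 - x by nlinarith),
            mul_nonneg hM0 (show 0 ≤ x ^ 2 - 1 by nlinarith)]
  obtain ⟨Cm, hCm⟩ := isCompact_Icc.exists_bound_of_continuousOn
    ((hχ'1.continuous).continuousOn (s := Icc a (a + 1)))
  set C : ℝ := max M (max Cm (|w| * M + M)) with hC
  have hχ'b : ∀ x, ‖deriv χ x‖ ≤ C := by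
    intro x
    by_cases hx : x < a
    · rw [hχ'0 x hx, norm_zero]; exact hM0.trans (le_max_left _ _)
    by_cases hx2 : a + 1 < x
    · rw [hχ'f x hx2]
      exact (hf₁b x (by linarith)).trans ((le_max_right _ _).trans (le_max_right _ _))
    · exact (hCm x ⟨by linarith, by linarith⟩).trans ((le_max_left _ _).trans (le_max_right _ _))
  -- `χ ∈ L²`
  have hχm : AEStronglyMeasurable χ volume := hχC.continuous.aestronglyMeasurable
  have hχL2 : MemLp χ 2 volume := by
    refine (memLp_indicator_inv ha0 M).of_le hχm (Eventually.of_forall fun x ↦ ?_)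
    by_cases hx : x < a
    · rw [hχ0 x hx, norm_zero]; exact norm_nonneg _
    · have hxpos : 0 < x := by linarith
      rw [indicator_of_mem (show x ∈ Ici a by exact not_lt.1 hx), Complex.norm_real, Real.norm_eq_abs,
        abs_of_nonneg (by positivity)]
      simp only [hχ, hf]
      rw [norm_mul, norm_div, Complex.norm_real, Complex.norm_real, Real.norm_eq_abs,
        Real.norm_eq_abs, abs_of_nonneg (hψ01 x).1, abs_of_pos hxpos, ← div_eq_mul_inv]
      calc ψ x * (‖T x‖ / x) ≤ 1 * (M / x) :=
            mul_le_mul (hψ01 x).2 (by gcongr; exact hTb x) (by positivity) zero_le_one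
        _ = M / x := one_mul _
  -- `Wχ ∈ L²`
  obtain ⟨Cw, hCw⟩ := isCompact_Icc.exists_bound_of_continuousOn
    (hWχc.continuousOn (s := Icc a (a + 1)))
  set K : ℝ := lam ^ 2 * w ^ 2 * M + 2 * lam ^ 2 * (|w| * M) + 2 * lam ^ 2 * M with hK
  have hK0 : 0 ≤ K := by positivity
  have hWb : ∀ x, a + 1 < x → ‖Wχ x‖ ≤ K / x := by
    intro x hx
    have hx1 : 1 ≤ x := by linarith
    have hxpos : 0 < x := by linarith
    rw [hWf x hx, le_div_iff₀ hxpos]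
    have e1 : ‖((lam ^ 2 * w ^ 2 : ℝ) : ℂ) * T x / x‖ * x = lam ^ 2 * w ^ 2 * ‖T x‖ := by
      rw [norm_div, norm_mul, Complex.norm_real, Complex.norm_real, Real.norm_eq_abs,
        Real.norm_eq_abs, abs_of_pos hxpos, abs_of_nonneg (by positivity)]
      field_simp
    have e2 : ‖((2 * lam ^ 2 : ℝ) : ℂ) * T₁ x / (x : ℂ) ^ 2‖ * x = 2 * lam ^ 2 * ‖T₁ x‖ / x := by
      rw [norm_div, norm_mul, norm_pow, Complex.norm_real, Complex.norm_real, Real.norm_eq_abs,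
        Real.norm_eq_abs, abs_of_pos hxpos, abs_of_nonneg (by positivity)]
      field_simp
    have e3 : ‖((2 * lam ^ 2 : ℝ) : ℂ) * T x / (x : ℂ) ^ 3‖ * x = 2 * lam ^ 2 * ‖T x‖ / x ^ 2 := by
      rw [norm_div, norm_mul, norm_pow, Complex.norm_real, Complex.norm_real, Real.norm_eq_abs,
        Real.norm_eq_abs, abs_of_pos hxpos, abs_of_nonneg (by positivity)]
      field_simp
    have h3 : 2 * lam ^ 2 * ‖T₁ x‖ / x ≤ 2 * lam ^ 2 * (|w| * M) := by
      rw [div_le_iff₀ hxpos]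
      calc 2 * lam ^ 2 * ‖T₁ x‖ ≤ 2 * lam ^ 2 * (|w| * M) := by gcongr; exact hT₁b x
        _ ≤ 2 * lam ^ 2 * (|w| * M) * x := le_mul_of_one_le_right (by positivity) hx1
    have h4 : 2 * lam ^ 2 * ‖T x‖ / x ^ 2 ≤ 2 * lam ^ 2 * M := by
      rw [div_le_iff₀ (by positivity)]
      calc 2 * lam ^ 2 * ‖T x‖ ≤ 2 * lam ^ 2 * M := by gcongr; exact hTb x
        _ ≤ 2 * lam ^ 2 * M * x ^ 2 := le_mul_of_one_le_right (by positivity) (by nlinarith)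
    calc ‖((lam ^ 2 * w ^ 2 : ℝ) : ℂ) * T x / x + ((2 * lam ^ 2 : ℝ) : ℂ) * T₁ x / (x : ℂ) ^ 2 -
          ((2 * lam ^ 2 : ℝ) : ℂ) * T x / (x : ℂ) ^ 3‖ * x
        ≤ (‖((lam ^ 2 * w ^ 2 : ℝ) : ℂ) * T x / x‖ + ‖((2 * lam ^ 2 : ℝ) : ℂ) * T₁ x / (x : ℂ) ^ 2‖ +
            ‖((2 * lam ^ 2 : ℝ) : ℂ) * T x / (x : ℂ) ^ 3‖) * x := by
          gcongr; exact (norm_sub_le _ _).trans (add_le_add (norm_add_le _ _) le_rfl)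
      _ = lam ^ 2 * w ^ 2 * ‖T x‖ + 2 * lam ^ 2 * ‖T₁ x‖ / x + 2 * lam ^ 2 * ‖T x‖ / x ^ 2 := by
          rw [add_mul, add_mul, e1, e2, e3]
      _ ≤ K := by rw [hK]; gcongr; exact hTb x
  set K₂ : ℝ := max K (Cw * (a + 1)) with hK₂
  have hWL2 : MemLp Wχ 2 volume := by
    refine (memLp_indicator_inv ha0 K₂).of_le hWχc.aestronglyMeasurable
      (Eventually.of_forall fun x ↦ ?_)
    by_cases hx : x < a
    · rw [hW0 x hx, norm_zero]; exact norm_nonneg _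
    · have hxpos : 0 < x := by linarith
      rw [indicator_of_mem (show x ∈ Ici a by exact not_lt.1 hx), Complex.norm_real,
        Real.norm_eq_abs, abs_of_nonneg (mul_nonneg (hK0.trans (le_max_left _ _)) (inv_nonneg.2 hxpos.le)),
        ← div_eq_mul_inv, le_div_iff₀ hxpos]
      by_cases hx2 : a + 1 < x
      · calc ‖Wχ x‖ * x ≤ K / x * x := by gcongr; exact hWb x hx2
          _ = K := by field_simp
          _ ≤ K₂ := le_max_left _ _
      · calc ‖Wχ x‖ * x ≤ Cw * (a + 1) := by
              gcongr
              · exact (norm_nonneg _).trans (hCw a ⟨le_rfl, by linarith⟩)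
              · exact hCw x ⟨by linarith, by linarith⟩
              · linarith
          _ ≤ K₂ := le_max_right _ _
  -- exact asymptotic identities for `x > a + 1`
  have hcl1 : ∀ x, a + 1 < x → (x : ℂ) * χ x = A₂ * sn x + B₂ * cs x := by
    intro x hx
    have hx' : (x : ℂ) ≠ 0 := Complex.ofReal_ne_zero.2 (by linarith)
    rw [(hχevf x hx).eq_of_nhds]
    simp only [hf, hT]
    field_simp
  have hcl2 : ∀ x, a + 1 < x → χ x + (x : ℂ) * deriv χ x = (w : ℂ) * (A₂ * cs x - B₂ * sn x) := by
    intro x hx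
    have hx' : (x : ℂ) ≠ 0 := Complex.ofReal_ne_zero.2 (by linarith)
    rw [(hχevf x hx).eq_of_nhds, hχ'f x hx]
    simp only [hf, hf₁, hT₁]
    field_simp
    ring
  refine ⟨χ, hχC, hχ0, hχ'0, hW0, ⟨C, fun x ↦ (hχb x).trans (le_max_left _ _), hχ'b⟩, hχL2, hWL2,
    fun x hx ↦ ?_, fun x hx ↦ ?_⟩
  · rw [hcl1 x hx]
  · rw [hcl2 x hx]

end TestFunction

/-! ## §4. `W_max`-symmetric elements have vanishing `+∞` coefficients -/

section Engine

variable (hlam : 0 < lam)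
include hlam

/-- **Engine at `+∞`.**  Let `ξ ∈ dom W_max` with regular representative `g` be `W_max`-symmetric
against every `ζ ∈ dom W_max` (e.g. `ξ ∈ dom W_min`), and let `A, B` be the `+∞` asymptotic
coefficients of `g` (`x g − (A sin + B cos)(2πλx) → 0`, `(g + xg′) − 2πλ(A cos − B sin) → 0`, as
produced by `exists_asymptotics_atTop_of_ftc`).  Then `A = B = 0`: testing `ξ` against the test
function `χ` of §3 with data `(A₂, B₂)` gives `0 = ⟪W_max ξ, ζ⟫ − ⟪ξ, W_max ζ⟫ = ∫_ℝ (conj η·χ − conj g·Wχ)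
= lim_R [ξ, χ](R) = −2πλ (conj(B) A₂ − conj(A) B₂)` (Lagrange's identity on `[λ + ½, R]` and §1),
and `(A₂, B₂) = (1, 0), (0, 1)` detect `B` and `A`.  ("The minimal domain is characterised by the
vanishing of the boundary values" — the `±∞` analogue of Lemma 1.2 (iv).)
[cite: ConnesMoscovici2022, Lemma 1.2 (iv), (1.17)–(1.18) and (1.20)–(1.21) (= arXiv:2112.05500 Lemma 2.2, (2.17)–(2.21), chunk p0004:L88–L99, p0006:L14–L24, L62–L69)] -/
theorem coeffs_eq_zero_of_inner_symm (ξ : (prolateMax lam).domain) {g : ℝ → ℂ}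
    (hae : ((ξ : L2R) : ℝ → ℂ) =ᵐ[volume] g) (hg : ContDiffOn ℝ 1 g {x | x ≠ lam ∧ x ≠ -lam})
    (hftc : ∀ x y, x ≤ y → Icc x y ⊆ {x | x ≠ lam ∧ x ≠ -lam} →
      pCoeff lam y * deriv g y - pCoeff lam x * deriv g x =
        ∫ t in x..y, (qCoeff lam t * g t - (prolateMax lam ξ : L2R) t))
    (hsym : ∀ ζ : (prolateMax lam).domain,
      ⟪(prolateMax lam ξ : L2R), (ζ : L2R)⟫_ℂ = ⟪(ξ : L2R), (prolateMax lam ζ : L2R)⟫_ℂ)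
    {A B : ℂ}
    (h1 : Tendsto (fun x : ℝ ↦ (x : ℂ) * g x -
      (A * (Real.sin (2 * π * lam * x) : ℂ) + B * (Real.cos (2 * π * lam * x) : ℂ))) atTop (𝓝 0))
    (h2 : Tendsto (fun x : ℝ ↦ (g x + (x : ℂ) * deriv g x) -
      ((2 * π * lam : ℝ) : ℂ) * (A * (Real.cos (2 * π * lam * x) : ℂ) -
        B * (Real.sin (2 * π * lam * x) : ℂ))) atTop (𝓝 0)) :
    A = 0 ∧ B = 0 := by
  set S : Set ℝ := {x | x ≠ lam ∧ x ≠ -lam} with hS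
  set η : ℝ → ℂ := fun t ↦ ((prolateMax lam ξ : L2R) : ℝ → ℂ) t with hη
  have hgi : ∀ x y, IntervalIntegrable g volume x y := fun x y ↦ by
    have h1 : IntegrableOn (fun t ↦ ((ξ : L2R) : ℝ → ℂ) t) (uIcc x y) :=
      ((Lp.memLp (ξ : L2R)).locallyIntegrable (by norm_num)).integrableOn_isCompact isCompact_uIcc
    exact (h1.congr_fun_ae (ae_restrict_of_ae hae)).intervalIntegrable
  have hgm : MemLp g 2 volume := (Lp.memLp (ξ : L2R)).ae_eq hae
  -- the key relation for arbitrary test data `(A₂, B₂)`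
  have key : ∀ A₂ B₂ : ℂ, star B * A₂ - star A * B₂ = 0 := by
    intro A₂ B₂
    have ha1 : (1 : ℝ) ≤ lam + 1 := by linarith
    obtain ⟨χ, hχ, hχ0, hχ'0, hW0, ⟨C, hb, hb'⟩, hχ2, hWχ2, hcl1, hcl2⟩ :=
      exists_testFunction lam ha1 A₂ B₂
    -- derivative bookkeeping for `χ`
    have h2' : ContDiff ℝ (1 + 1) χ := by simpa [one_add_one_eq_two] using hχ
    have hχ'1 : ContDiff ℝ 1 (deriv χ) := (contDiff_succ_iff_deriv.mp h2').2.2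
    have hχ'd : Differentiable ℝ (deriv χ) := hχ'1.differentiable one_ne_zero
    have hχ''c : Continuous (deriv (deriv χ)) := hχ'1.continuous_deriv le_rfl
    have hχ1 : ContDiff ℝ 1 χ := hχ.of_le (by norm_num)
    set u : ℝ → ℂ := fun s ↦ pCoeff lam s * deriv χ s with hu
    have hud : ∀ s, HasDerivAt u
        (((-(2 * s) : ℝ) : ℂ) * deriv χ s + pCoeff lam s * deriv (deriv χ) s) s := fun s ↦
      (hasDerivAt_pCoeff₄ lam s).mul (hχ'd s).hasDerivAt
    have hu'c : Continuous (deriv u) := by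
      rw [show deriv u = _ from funext fun s ↦ (hud s).deriv]
      exact ((Complex.continuous_ofReal.comp (by fun_prop)).mul hχ'1.continuous).add
        ((continuous_pCoeff₄ lam).mul hχ''c)
    set Wχ : ℝ → ℂ := fun t ↦ -deriv (fun s ↦ pCoeff lam s * deriv χ s) t + qCoeff lam t * χ t
      with hWχ
    have hWχc : Continuous Wχ := hu'c.neg.add ((continuous_qCoeff₄ lam).mul hχ.continuous)
    -- the test element `ζ = [χ]`, `W_max ζ = [Wχ]`
    obtain ⟨hdom, hWζ⟩ := mem_prolateMax_of_contDiff_of_bounded lam hχ hb hb' hχ2 hWχ2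
    set ζ : (prolateMax lam).domain := ⟨hχ2.toLp χ, hdom⟩ with hζ
    have hζae : ((ζ : L2R) : ℝ → ℂ) =ᵐ[volume] χ := hχ2.coeFn_toLp
    have hWζae : ((prolateMax lam ζ : L2R) : ℝ → ℂ) =ᵐ[volume] Wχ := by
      rw [hWζ]; exact hWχ2.coeFn_toLp
    -- `∫_ℝ F = 0`, `F = conj η · χ − conj g · Wχ`
    set F : ℝ → ℂ := fun t ↦ star (η t) * χ t - star (g t) * Wχ t with hF
    have hFint : Integrable F :=
      ((memLp_two_star₄ (Lp.memLp _)).integrable_mul hχ2).sub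
        ((memLp_two_star₄ hgm).integrable_mul hWχ2)
    have hF0 : ∫ t, F t = 0 := by
      have h0 := integral_F_eq_inner_sub (η₁ := (prolateMax lam ξ : L2R))
        (η₂ := (prolateMax lam ζ : L2R)) hae hζae
      rw [hsym ζ, sub_self] at h0
      rw [← h0]
      refine integral_congr_ae ?_
      filter_upwards [hWζae] with t ht
      rw [hF, ht]
    -- base point `b₀ = λ + 1/2`: `χ`, `Wχ` vanish on `(−∞, λ + 1)`
    set b₀ : ℝ := lam + 1 / 2 with hb₀
    have hb₀a : b₀ < lam + 1 := by rw [hb₀]; linarith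
    have hFb : ∫ t in Ioi b₀, F t = 0 := by
      rw [setIntegral_eq_integral_of_forall_compl_eq_zero fun t ht ↦ ?_, hF0]
      have ht' : t < lam + 1 := by rw [mem_Ioi, not_lt] at ht; linarith
      have hWt : Wχ t = 0 := hW0 t ht'
      simp only [hF, hχ0 t ht', hWt, mul_zero, sub_zero]
    -- Lagrange on `[b₀, R]`: `∫_{b₀}^R F = BF(R)`
    have hftcχ : ∀ x y, x ≤ y → Icc x y ⊆ S →
        pCoeff lam y * deriv χ y - pCoeff lam x * deriv χ x =
          ∫ t in x..y, (qCoeff lam t * χ t - ((prolateMax lam ζ : L2R) : ℝ → ℂ) t) := by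
      intro x y _ _
      have e1 : ∫ t in x..y, (qCoeff lam t * χ t - ((prolateMax lam ζ : L2R) : ℝ → ℂ) t) =
          ∫ t in x..y, deriv u t := by
        refine intervalIntegral.integral_congr_ae ?_
        filter_upwards [hWζae] with t ht _
        have hd : deriv (fun s ↦ pCoeff lam s * deriv χ s) t =
            (((-(2 * t) : ℝ)) : ℂ) * deriv χ t + pCoeff lam t * deriv (deriv χ) t := (hud t).deriv
        rw [ht, (hud t).deriv,
          show Wχ t = -deriv (fun s ↦ pCoeff lam s * deriv χ s) t + qCoeff lam t * χ t from rfl, hd]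
        ring
      rw [e1, intervalIntegral.integral_deriv_eq_sub (fun t _ ↦ (hud t).differentiableAt)
        (hu'c.intervalIntegrable _ _)]
    have hLag : ∀ R, b₀ ≤ R → ∫ t in b₀..R, F t =
        star (g R) * (pCoeff lam R * deriv χ R) - star (pCoeff lam R * deriv g R) * χ R := by
      intro R hR
      have hI : Icc b₀ R ⊆ S := fun t ht ↦
        ⟨by intro h; rw [h, hb₀] at ht; linarith [ht.1], by intro h; rw [h, hb₀] at ht; linarith [ht.1]⟩
      have hL := intervalIntegral_lagrange_pair (η₁ := (prolateMax lam ξ : L2R))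
        (η₂ := (prolateMax lam ζ : L2R)) hg hftc hχ1.contDiffOn hftcχ hR hI
      have e1 : ∫ t in b₀..R, F t = ∫ t in b₀..R,
          (star (η t) * χ t - star (g t) * ((prolateMax lam ζ : L2R) : ℝ → ℂ) t) := by
        refine intervalIntegral.integral_congr_ae ?_
        filter_upwards [hWζae] with t ht _
        rw [hF, ht]
      rw [e1, hL, hχ0 b₀ hb₀a, hχ'0 b₀ hb₀a]
      simp
    -- hence `BF(R) → 0`
    have hBF0 : Tendsto (fun R ↦ star (g R) * (pCoeff lam R * deriv χ R) -
        star (pCoeff lam R * deriv g R) * χ R) atTop (𝓝 0) := by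
      have h := intervalIntegral_tendsto_integral_Ioi b₀ hFint.integrableOn tendsto_id
      rw [hFb] at h
      refine h.congr' ?_
      filter_upwards [eventually_ge_atTop b₀] with R hR
      exact hLag R hR
    -- and `BF(R) → −ω (conj B · A₂ − conj A · B₂)` by §1
    have hχ1' : Tendsto (fun x : ℝ ↦ (x : ℂ) * χ x -
        (A₂ * (Real.sin (2 * π * lam * x) : ℂ) + B₂ * (Real.cos (2 * π * lam * x) : ℂ)))
        atTop (𝓝 0) := by
      refine tendsto_const_nhds.congr' ?_
      filter_upwards [eventually_gt_atTop (lam + 1 + 1)] with x hx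
      rw [hcl1 x hx, sub_self]
    have hχ2' : Tendsto (fun x : ℝ ↦ (χ x + (x : ℂ) * deriv χ x) -
        ((2 * π * lam : ℝ) : ℂ) * (A₂ * (Real.cos (2 * π * lam * x) : ℂ) -
          B₂ * (Real.sin (2 * π * lam * x) : ℂ))) atTop (𝓝 0) := by
      refine tendsto_const_nhds.congr' ?_
      filter_upwards [eventually_gt_atTop (lam + 1 + 1)] with x hx
      rw [hcl2 x hx, sub_self]
    have hBFL := tendsto_boundaryForm_of_asymptotics lam h1 h2 hχ1' hχ2'
    have hlim := tendsto_nhds_unique hBFL hBF0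
    have hω : ((2 * π * lam : ℝ) : ℂ) ≠ 0 :=
      Complex.ofReal_ne_zero.2 (by positivity)
    have := mul_eq_zero.1 hlim
    rcases this with h | h
    · exact absurd (neg_eq_zero.1 h) hω
    · exact h
  have hB := key 1 0
  have hA := key 0 1
  simp only [mul_one, mul_zero, sub_zero, zero_sub, neg_eq_zero, star_eq_zero] at hB hA
  exact ⟨hA, hB⟩

end Engine

end Literature.NumberTheory.ConnesMoscovici2022

end
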